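import Summits.Ventures.MM22.Rank333.ProfileCertMain
import Summits.Ventures.MM22.Rank333.GF2ProfileSymmetry
import Summits.Ventures.MM22.Rank333.LowerBounds
import HarnessLib

/-!
# MM22 venture — PROFILE-CERT kernel replay: the glue to `Cert` / `RankGe21F2`

HONEST FRAMING (cell `pub-mm22`, seat p1 g5; V4-MENU item (0′) «kernel replay of the whole-root PROFILE-CERT»).
Checker PLUMBING with soundness theorems, written from the FROZEN format specification
`HOME/pub-mm22-p2/pcert/PROFILE-CERT-v1-frozen-20260822T2120Z.md` (sha256 59fc6c87…) only. The end declaration of the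
chain (`ProfileCertGlue.rankGe21F2_of_pieces`) is an IMPLICATION whose antecedents are Wang's `Cert 3 3 3 [] 20`, a
certified orbit table (Wang's printed values and the cell's 8 LP/LPDFS lifts), a passing singleton check and the
`NoExt` statement that the (not yet landed) data files assemble to. NOTHING here proves a bound on `R_𝔽₂(⟨3,3,3⟩)`;
no summit claim.

This file: the root validity predicate `VRoot` built on LIT-2's `ValidAll` (`GF2ProfileSymmetry`), `vhyp_root`,
`cert21_of_noExt`, the row-dictionary and singleton soundness (`rowCert_of_dictOK`, `cert_single_of_singlesOK`), and
the end implication `rankGe21F2_of_pieces`.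
-/

set_option autoImplicit false

namespace Summit.Ventures.MM22.ProfileCert

section Glue0

open Summit.MatrixMultiplication.OmegaCensus.GF2RankLB Summit.Ventures.MM22.GF2Cert.Profile Matrix

/-- Row certification of a stored row: it is empty, or its members are exactly a pattern list `K` carrying a
certificate `Cert 3 3 3 K b` with `N ≤ b + cap`.  (Discharged per file from the row dictionary; default rows of the
trie are empty.) -/
def RowCert (N : ℕ) (r : Row) : Prop :=
  r.mask = 0 ∨ ∃ (K : List ℕ) (b : ℕ), (∀ f, f ∈ K ↔ r.mask.testBit f = true) ∧ Cert 3 3 3 K b ∧ N ≤ b + r.cap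

/-- **The validity predicate of the root instance**: images of injective `N`-profiles of nonzero patterns that are
valid against every certified row (`ValidAll`). -/
def VRoot (N : ℕ) (M : Finset ℕ) : Prop :=
  ∃ prof : Fin N → ℕ, (∀ i, prof i ≠ 0) ∧ (∀ i, prof i < 2 ^ 9) ∧ Function.Injective prof ∧
    ValidAll 3 3 3 N prof ∧ M = Finset.univ.image prof

/-- `mulBits 3 3 3` is a 9-bit pattern. -/
theorem mulBits33_lt (x y : ℕ) : mulBits 3 3 3 x y < 2 ^ 9 := maskOf_lt _ _
/-- `oneBits 3` is a 9-bit pattern. -/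
theorem oneBits3_lt : oneBits 3 < 2 ^ 9 := maskOf_lt _ _

/-- Raw inverse equations from `invOK`. -/
theorem MapW.invOK_raw {mp : MapW} (h : mp.invOK = true) :
    mulBits 3 3 3 mp.P mp.Pi = oneBits 3 ∧ mulBits 3 3 3 mp.Pi mp.P = oneBits 3 ∧
    mulBits 3 3 3 mp.Q mp.Qi = oneBits 3 ∧ mulBits 3 3 3 mp.Qi mp.Q = oneBits 3 := by
  unfold MapW.invOK at h
  simp only [Bool.and_eq_true, beq_iff_eq] at h
  exact ⟨h.1.1.1, h.1.1.2, h.1.2, h.2⟩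

/-- Transposed inverse witnesses: `(Piᵀ)(Pᵀ) = 1` from `P Pi = 1`. -/
theorem mulBits_tr3_tr3_eq_one {A B : ℕ} (h : mulBits 3 3 3 A B = oneBits 3) :
    mulBits 3 3 3 (tr3 B) (tr3 A) = oneBits 3 := by
  apply eq_of_ofBits_eq (mulBits33_lt _ _) oneBits3_lt
  rw [ofBits_mulBits, ofBits_tr3, ofBits_tr3, ← Matrix.transpose_mul, ofBits_eq_one_of_mulBits_eq h,
    Matrix.transpose_one, ofBits_oneBits]

/-- Our plain generator action is the tree's `pullB` with transposed parameters. -/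
theorem sigma_eq_pullB (P Q X : ℕ) : sigma P Q 0 X = pullB 3 3 (tr3 P) (tr3 Q) X := by
  apply eq_of_ofBits_eq (sigma_lt _ _ _ _) (pullB_lt 3 3 _ _ _)
  rw [ofBits_sigma, ofBits_pullB, ofBits_tr3, ofBits_tr3, Matrix.transpose_transpose, Matrix.transpose_transpose]
  simp [Matrix.mul_assoc]

/-- Our transposed generator action is the tree's `pullTB` with swapped parameters. -/
theorem sigma_eq_pullTB (P Q X : ℕ) : sigma P Q 1 X = pullTB 3 Q P X := by
  apply eq_of_ofBits_eq (sigma_lt _ _ _ _) (pullTB_lt 3 _ _ _)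
  rw [ofBits_sigma, ofBits_pullTB]
  simp [Matrix.mul_assoc]

/-- **The validity hypotheses hold for the root predicate**, given certified rows. -/
theorem vhyp_root {N : ℕ} {rt : RT} (hrt : ∀ i, RowCert N (rt.get i)) : VHyp rt N (VRoot N) := by
  classical
  refine ⟨⟨?_, ?_, ?_⟩, ?_⟩
  · rintro M ⟨prof, _, _, hinj, _, rfl⟩
    rw [Finset.card_image_of_injective _ hinj, Finset.card_univ, Fintype.card_fin]
  · rintro M ⟨prof, h0, hlt, _, _, rfl⟩ f hf
    obtain ⟨i, _, rfl⟩ := Finset.mem_image.1 hf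
    rw [mem_forms, NF]
    have := h0 i; have := hlt i; omega
  · rintro M ⟨prof, h0, hlt, hinj, hval, rfl⟩ i
    rcases hrt i with hz | ⟨K, b, hK, hC, hNb⟩
    · have : (Finset.univ.image prof).filter (fun f => (rt.get i).mask.testBit f = true) = ∅ := by
        ext f; simp [hz, Nat.zero_testBit]
      rw [this, Finset.card_empty]; exact Nat.zero_le _
    · have h1 := hval K b hC
      have h2 : ((Finset.univ.image prof).filter fun f => (rt.get i).mask.testBit f = true)
          = (Finset.univ.filter fun j => prof j ∈ K).image prof := by
        ext f
        simp only [Finset.mem_filter, Finset.mem_image, Finset.mem_univ, true_and]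
        constructor
        · rintro ⟨⟨j, rfl⟩, hf⟩; exact ⟨j, (hK _).2 hf, rfl⟩
        · rintro ⟨j, hj, rfl⟩; exact ⟨⟨j, rfl⟩, (hK _).1 hj⟩
      rw [h2, Finset.card_image_of_injective _ hinj]
      omega
  · rintro mp hinv M ⟨prof, h0, hlt, hinj, hval, rfl⟩
    have hb := bijOn_of_invOK hinv
    have hforms : ∀ i, prof i ∈ forms := fun i => by rw [mem_forms, NF]; have := h0 i; have := hlt i; omega
    obtain ⟨r1, _, _, r4⟩ := MapW.invOK_raw hinv
    refine ⟨fun i => mp.sigma (prof i), fun i => ?_, fun i => sigma_lt _ _ _ _, fun i j hij => ?_, ?_, ?_⟩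
    · have := hb.mapsTo (Finset.mem_coe.2 (hforms i))
      rw [Finset.mem_coe, mem_forms] at this
      exact Nat.one_le_iff_ne_zero.1 this.1
    · exact hinj (hb.injOn (Finset.mem_coe.2 (hforms i)) (Finset.mem_coe.2 (hforms j)) hij)
    · have hlt' : ∀ i, prof i < 2 ^ (3 * 3) := fun i => by simpa using hlt i
      by_cases ht : mp.t = 1
      · have key := validAll_comp_pullTB (l := 3) (n := 3) (N := N) (P := mp.Q) (Pi := mp.Qi) (Q := mp.P)
          (Qi := mp.Pi) r4 r1 hlt' hval
        have heq : (fun i => mp.sigma (prof i)) = fun i => pullTB 3 mp.Q mp.P (prof i) := by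
          funext i; unfold MapW.sigma; rw [ht]; exact sigma_eq_pullTB _ _ _
        rw [heq]; exact key
      · have ht0 : mp.t = 0 ∨ 2 ≤ mp.t := by omega
        have key := validAll_comp_pullB (l := 3) (m := 3) (n := 3) (N := N) (P := tr3 mp.P) (Pi := tr3 mp.Pi)
          (Q := tr3 mp.Q) (Qi := tr3 mp.Qi) (mulBits_tr3_tr3_eq_one r1) (mulBits_tr3_tr3_eq_one r4) hlt' hval
        have heq : (fun i => mp.sigma (prof i)) = fun i => pullB 3 3 (tr3 mp.P) (tr3 mp.Q) (prof i) := by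
          funext i
          unfold MapW.sigma
          rw [← sigma_eq_pullB]
          unfold sigma
          rw [if_neg ht]
          rfl
        rw [heq]; exact key
    · rw [Finset.image_image]; rfl

/-- **Root step**: Wang's `Cert [] 20`, the singleton rows `Cert [x] 19` (orbits 492/493/494 at their printed
value 19, transported to every nonzero pattern), and `NoExt` for the root validity predicate at the empty state give
`Cert 3 3 3 [] 21`. -/
theorem cert21_of_noExt (h20 : Cert 3 3 3 [] 20) (hsingle : ∀ x, x ≠ 0 → x < 2 ^ 9 → Cert 3 3 3 [x] 19)
    (hno : NoExt (VRoot 20) ⟨[], 0, 0, 0⟩) : Cert 3 3 3 [] 21 := by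
  classical
  apply cert_succ_of_noValidAll h20
  intro prof h0 hlt hval
  have hlt' : ∀ i, prof i < 2 ^ 9 := fun i => by simpa using hlt i
  have hinj : Function.Injective prof := by
    intro i j hij
    by_contra hne
    have h1 := hval [prof i] 19 (hsingle _ (h0 i) (hlt' i))
    have h2 : 2 ≤ (Finset.univ.filter fun k => prof k ∈ [prof i]).card := by
      have hsub : ({i, j} : Finset (Fin 20)) ⊆ Finset.univ.filter fun k => prof k ∈ [prof i] := by
        intro k hk
        simp only [Finset.mem_insert, Finset.mem_singleton] at hk
        simp only [Finset.mem_filter, Finset.mem_univ, true_and, List.mem_singleton]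
        rcases hk with rfl | rfl
        · rfl
        · exact hij.symm
      have := Finset.card_le_card hsub
      rwa [Finset.card_pair hne] at this
    omega
  exact no_valid_of_noExt_init hno _ ⟨prof, h0, hlt', hinj, hval, rfl⟩

/-- **End shape** of the kernel route: `RankGe21F2` from the three inputs of `cert21_of_noExt`. -/
theorem rankGe21F2_of_noExt (h20 : Cert 3 3 3 [] 20) (hsingle : ∀ x, x ≠ 0 → x < 2 ^ 9 → Cert 3 3 3 [x] 19)
    (hno : NoExt (VRoot 20) ⟨[], 0, 0, 0⟩) : RankGe21F2 :=
  le_tensorRank_of_cert_nil (cert21_of_noExt h20 hsingle hno)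


end Glue0

section Dict0

open Summit.MatrixMultiplication.OmegaCensus.GF2RankLB Summit.Ventures.MM22.GF2Cert.Profile Matrix
  Literature.Computability.AlgebraicComplexity

/-- `0` is always in the span list. -/
theorem zero_mem_spanList : ∀ (vs : List ℕ), 0 ∈ spanList vs
  | [] => by simp [spanList]
  | v :: vs => by
    simp only [spanList]
    exact List.mem_append_left _ (zero_mem_spanList vs)

/-- Every element of `spanList basis` vanishes (as a form) wherever the basis forms vanish. -/
theorem form_spanList_eq_zero {u : Matrix (Fin 3) (Fin 3) (ZMod 2)} :
    ∀ (vs : List ℕ), (∀ v ∈ vs, form 3 3 v u = 0) → ∀ x ∈ spanList vs, form 3 3 x u = 0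
  | [], _, x, hx => by
    simp only [spanList, List.mem_singleton] at hx
    subst hx; rw [form_zero]; rfl
  | v :: vs, hvs, x, hx => by
    simp only [spanList, List.mem_append, List.mem_map] at hx
    have ih := form_spanList_eq_zero vs (fun w hw => hvs w (List.mem_cons_of_mem v hw))
    rcases hx with hx | ⟨y, hy, rfl⟩
    · exact ih x hx
    · rw [form_xor, LinearMap.add_apply, ih y hy, hvs v (by simp), add_zero]

/-- `S_basis ≤ S_K` when `K ⊆ spanList basis`. -/
theorem subOf_le_of_subset_span {basis K : List ℕ} (hK : ∀ x ∈ K, x ∈ spanList basis) :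
    subOf 3 3 basis ≤ subOf 3 3 K := by
  intro u hu
  rw [subOf, mem_constrSub] at hu ⊢
  intro κ' hκ'
  obtain ⟨κ, hκ, rfl⟩ := List.mem_map.1 hκ'
  exact form_spanList_eq_zero basis (fun v hv => hu _ (List.mem_map.2 ⟨v, hv, rfl⟩)) κ (hK κ hκ)

/-- A certificate for a basis is a certificate for any list of forms inside its span. -/
theorem cert_of_subset_span {basis K : List ℕ} {b : ℕ} (h : Cert 3 3 3 basis b)
    (hK : ∀ x ∈ K, x ∈ spanList basis) : Cert 3 3 3 K b :=
  fun r β => h r (β.ofLE (subOf_le_of_subset_span hK))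

/-- Soundness of one dictionary entry: its mask's member list carries `Cert … lb`. -/
theorem RowSrc.cert_of_ok {reps : ℕ → List ℕ × ℕ} (hreps : ∀ idx, Cert 3 3 3 (reps idx).1 (reps idx).2)
    {r : RowSrc} (h : r.ok reps = true) :
    ∃ K : List ℕ, (∀ f, f ∈ K ↔ r.mask.testBit f = true) ∧ Cert 3 3 3 K r.lb := by
  unfold RowSrc.ok at h
  simp only [Bool.and_eq_true, decide_eq_true_eq, List.all_eq_true] at h
  obtain ⟨⟨⟨hmask, hlb⟩, hkr⟩, hsand⟩ := h
  -- the echelon representative basis is certified (same span as the table basis), then transport to this row's basis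
  have hkrC : Cert 3 3 3 r.kr r.lb := by
    have hrep := hreps r.orbit
    rw [hlb] at hrep
    exact cert_of_subset_span hrep fun x hx => by
      have := hkr x hx
      rwa [List.elem_eq_mem, decide_eq_true_eq] at this
  have hbasis : Cert 3 3 3 r.basis r.lb := by
    split at hsand
    · exact fun n β => le_of_sandTB (sandTB_of_sandTFB hsand) hkrC n β
    · exact fun n β => le_of_sandB (sandB_of_sandFB hsand) hkrC n β
  refine ⟨(spanList r.basis).filter (· ≠ 0), fun f => ?_, cert_of_subset_span hbasis fun x hx => (List.mem_filter.1 hx).1⟩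
  rw [hmask, Nat.testBit_xor, List.mem_filter]
  have h1 := (mem_iff_testBit_maskOf (spanList r.basis) f).symm
  have h2 : (1 : ℕ).testBit f = decide (f = 0) := by
    cases f with
    | zero => rfl
    | succ n => rw [Nat.testBit_succ]; simp
  rw [h2]
  have h0 := zero_mem_spanList r.basis
  cases hm : (maskOf (spanList r.basis)).testBit f <;> by_cases hf0 : f = 0 <;> simp_all

/-- Leaves of the store: every index hits the empty default or a leaf satisfying `p`. -/
theorem RT.get_of_allLeaves {p : Row → Bool} : ∀ (t : RT), t.allLeaves p = true → ∀ i, t.get i = ⟨0, 0, 0⟩ ∨ p (t.get i) = true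
  | .nil, _, i => Or.inl rfl
  | .leaf r, h, i => Or.inr (by simpa [RT.allLeaves, RT.get] using h)
  | .node l r, h, i => by
    simp only [RT.allLeaves, Bool.and_eq_true] at h
    simp only [RT.get]
    split
    · exact RT.get_of_allLeaves l h.1 (i / 2)
    · exact RT.get_of_allLeaves r h.2 (i / 2)

/-- **Row dictionary soundness**: a passing dictionary check certifies every stored row (given the orbit table). -/
theorem rowCert_of_dictOK {N : ℕ} {reps : ℕ → List ℕ × ℕ} (hreps : ∀ idx, Cert 3 3 3 (reps idx).1 (reps idx).2)
    {rt : RT} {dict : List RowSrc} (h : dictOK N reps rt dict = true) : ∀ i, RowCert N (rt.get i) := by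
  unfold dictOK at h
  simp only [Bool.and_eq_true, List.all_eq_true] at h
  obtain ⟨hall, hleaves⟩ := h
  intro i
  rcases RT.get_of_allLeaves rt hleaves i with h0 | hp
  · left; rw [h0]
  · simp only [Bool.or_eq_true, beq_iff_eq, List.any_eq_true, Bool.and_eq_true, decide_eq_true_eq] at hp
    rcases hp with hz | ⟨r, hr, hmask, hcap⟩
    · exact Or.inl hz
    · obtain ⟨K, hK, hC⟩ := RowSrc.cert_of_ok hreps (hall r hr)
      exact Or.inr ⟨K, r.lb, fun f => by rw [hK, hmask], hC, hcap⟩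

/-- **Singles soundness**: a passing singles check certifies `Cert [x] b` for every form `x`. -/
theorem cert_single_of_singlesOK {b : ℕ} {reps : ℕ → List ℕ × ℕ} (hreps : ∀ idx, Cert 3 3 3 (reps idx).1 (reps idx).2)
    {ws : List Single} (h : singlesOK b reps ws = true) : ∀ x, x ≠ 0 → x < 2 ^ 9 → Cert 3 3 3 [x] b := by
  unfold singlesOK at h
  simp only [Bool.and_eq_true, decide_eq_true_eq, List.all_eq_true] at h
  obtain ⟨hcover, hall⟩ := h
  intro x hx0 hxlt
  have hxmem : x ∈ ws.map Single.x := by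
    rw [hcover, List.mem_map]
    refine ⟨x - 1, List.mem_range.2 ?_, by omega⟩
    rw [NF]; omega
  obtain ⟨w, hw, rfl⟩ := List.mem_map.1 hxmem
  obtain ⟨hb, hsand⟩ := hall w hw
  have hrep := hreps w.orbit
  intro n β
  exact hb.trans (le_of_sandB (sandB_of_sandFB hsand) hrep n β)

/-- `RefsOK` from a pointwise statement over the listed entry states (assembly helper). -/
theorem refsOK_of_forall {V : Finset ℕ → Prop} {refs : List Entry}
    (h : ∀ e ∈ refs, NoExt V ⟨e.inL, e.out, e.inL.length, e.nOut⟩) : RefsOK V refs :=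
  fun _ e hk => h e (List.mem_of_getElem? hk)

/-- Row certification from the entry checks (however obtained) and the leaf check (assembly helper). -/
theorem rowCert_of_parts {N : ℕ} {reps : ℕ → List ℕ × ℕ} (hreps : ∀ idx, Cert 3 3 3 (reps idx).1 (reps idx).2)
    {rt : RT} {dict : List RowSrc} (hall : ∀ r ∈ dict, r.ok reps = true)
    (hleaves : (rt.allLeaves fun row => (row.mask == 0) || dict.any (fun r => r.mask == row.mask && decide (N ≤ r.lb + row.cap))) = true) :
    ∀ i, RowCert N (rt.get i) := by
  intro i
  rcases RT.get_of_allLeaves rt hleaves i with h0 | hp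
  · left; rw [h0]
  · simp only [Bool.or_eq_true, beq_iff_eq, List.any_eq_true, Bool.and_eq_true, decide_eq_true_eq] at hp
    rcases hp with hz | ⟨r, hr, hmask, hcap⟩
    · exact Or.inl hz
    · obtain ⟨K, hK, hC⟩ := RowSrc.cert_of_ok hreps (hall r hr)
      exact Or.inr ⟨K, r.lb, fun f => by rw [hK, hmask], hC, hcap⟩

/-- Row certification of a composed store (assembly helper). -/
theorem rowCert_node {N : ℕ} {l r : RT} (hl : ∀ i, RowCert N (l.get i)) (hr : ∀ i, RowCert N (r.get i)) :
    ∀ i, RowCert N ((RT.node l r).get i) := by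
  intro i
  simp only [RT.get]
  split
  · exact hl _
  · exact hr _

/-- `List.all` of an append from its parts (assembly helper). -/
theorem all_ok_append {p : RowSrc → Bool} {l₁ l₂ : List RowSrc} (h₁ : l₁.all p = true) (h₂ : l₂.all p = true) :
    (l₁ ++ l₂).all p = true := by
  rw [List.all_append, h₁, h₂]; rfl

/-- **Assembled end shape**: with the orbit table certified (`hreps`: Wang's printed values and the lifts), Wang's
`Cert [] 20`, a passing singles check at `19`, and `NoExt` for the root predicate at the empty state,
`R_𝔽₂(⟨3,3,3⟩) ≥ 21`. -/
theorem rankGe21F2_of_pieces {reps : ℕ → List ℕ × ℕ} (hreps : ∀ idx, Cert 3 3 3 (reps idx).1 (reps idx).2)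
    (h20 : Cert 3 3 3 [] 20) {ws : List Single} (hws : singlesOK 19 reps ws = true)
    (hno : NoExt (VRoot 20) ⟨[], 0, 0, 0⟩) : RankGe21F2 :=
  rankGe21F2_of_noExt h20 (cert_single_of_singlesOK hreps hws) hno


end Dict0

end Summit.Ventures.MM22.ProfileCert
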